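import Literature.AnabelianGeometry.EtaleTheta.Discharge.Sec4GaloisLiftOfFullEssSurj
import Literature.AnabelianGeometry.EtaleTheta.Discharge.Sec4CondDOfRootLaw

/-!
# [EtTh] Def. 4.1 (i) ERRATUM E2 at the v2 TOWER DATUM: condition (d) of the canonical §4 model from E2 (a)
# `RootLaw (ofTower T)` ALONE (lift of coverings now a theorem for every full, essentially surjective base)

S. Mochizuki, *The étale theta function …*, Publ. RIMS **45** (2009) [MochizukiEtTh2009], §3 Def. 3.3 (iii) p.73, §4
Def. 4.1 (i) p.86, Prop. 4.2 (iii) p.89; ERRATUM E2 = [IUTchI] Rmk. 3.2.4 (iv) (approaches (A)/(B))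
[cite: MochizukiEtTh2009, Def 4.1 (i) p.86].  abc-iut cell, layer L2; seat abc-iut-L2-t3 (gen 5; E2 owner).  PROOF-ONLY
(0 defs); nothing landed is edited.

The C-R34 (3) kernel chain of record, END TO END, as theorems by name with the lift binder `hLift` DISCHARGED:
`(DivisorMonoids.ofTower T).RootLaw` (E2 (a) on the covering-indexed Def. 3.3 (iii) datum, p455437/p455508)
⟹ A10 `BaseRootLaw «Galois»` / `BaseRootLaw ⊤` (`Sec4GaloisLiftOfFullEssSurj`, p456136: every full, essentially
surjective base `D → B^temp(Π)⁰`) ⟹ hR (`rootLaw_of_baseRootLaw'`) ⟹ approach (B)'s condition (d) at every admissible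
object of the canonical §4 model (`Sec4CondDOfRootLaw`, p450859).
* `BiKummerSetting.Prop42Sub.condD_mkOfModelCanonical_of_rootLaw_of_full_essSurj` — for EVERY Def. 3.3 (iii) datum
  `dm` over `B^temp(Π)⁰`: `dm.RootLaw` + (`Φ` perfect, `Φ` divisorial, `hTF`) ⟹ `CondD` at every `IG := ⊤`-object;
  `…_galois_…` — the same with `IG := «tf.base A is Galois»` (`Π` tempered);
* `…condD_mkOfModelCanonical_ofTower_of_rootLaw` — the same AT `dm := DivisorMonoids.ofTower T`.
The remaining binders are the STANDING §4-model binders of p450859 (`hP` Φ perfect, `hΦd` Φ divisorial, `hTF` `N`-th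
powers injective on `(Φ^{ℝ})^gp`, the Galois data `gS`/`gSs`, `NH`, the Frobenius-trivial anchor `A₀`) — none new.
HONEST FRAMING: implications between OUR typed predicates; no instance of `RootLaw (ofTower T)` with non-trivial `B₀`
is claimed (abc-iut-w6-d058's NV); typed ≠ proved; nothing here bears on the disputed [IUTchIII] Cor. 3.12.
-/

noncomputable section

namespace Literature.AnabelianGeometry.EtaleTheta

open CategoryTheory Opposite Function Literature.AlgebraicGeometry.Frobenioids
  Literature.AlgebraicGeometry.Frobenioids.QuasiTemperoid Literature.AnabelianGeometry.SemiGraphs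
  Literature.AnabelianGeometry.SemiGraphs.GaloisObjects

universe u₀ u v w

variable {K : Type (u + 1)} [Field K]

namespace BiKummerSetting

section OverBTemp

variable (X : SemiGraphs.TemperedArithmeticGroup.{u + 1} K) {G : Type u} [Group G] [TopologicalSpace G]
  {dm : DivisorMonoids.{u + 1, u, w} (ConnectedPart (BTemp G))}
  {hpf : ∀ Y : (ConnectedPart (BTemp G))ᵒᵖ, IsPerfFactorialCof (dm.Φ₀.obj Y)}
  {D : Type u₀} [Category.{v} D] {VD : FrdICatStub.{u₀, v, w} D}
  (tf : TemperedFrobenioid (RealifiedDivisorMonoids.ofRlfZWeak dm hpf) D VD) [tf.base.Full] [tf.base.EssSurj]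
  (hP : ∀ A : Dᵒᵖ, IsPerfect (tf.Φ.carrier A))

/-- **Condition (d) at EVERY object of the canonical §4 model (`IG := ⊤`) from E2 (a) on the Def. 3.3 (iii) data ALONE**
(base functor full and essentially surjective — print's `D = D₀[𝒟] → D₀`; no temperedness needed for `IG = ⊤`).
[cite: MochizukiEtTh2009, Def 4.1 (i) p.86] -/
theorem Prop42Sub.condD_mkOfModelCanonical_of_rootLaw_of_full_essSurj
    (gS : ∀ A : D, True → (X.Pi →* Aut A)) (gSs : ∀ (A : D) (h : True), Function.Surjective (gS A h))
    (NH : Subgroup (Field.absoluteGaloisGroup K) → tf.category → ℕ+ → Prop) (A₀ : tf.category)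
    (hA₀ : PreFrobenioid.IsFrobeniusTrivial tf.toElem A₀)
    (hΦd : Objectwise (fun M _ => IsDivisorial M) tf.divisorMonoid)
    (hTF : ∀ (A : D) (N : ℕ), 0 < N →
      Function.Injective fun x : Algebra.GrothendieckGroup
        ((RealifiedDivisorMonoids.ofRlfZWeak dm hpf).ΦR.obj (op (tf.base.obj A))) => x ^ N)
    (hR : dm.RootLaw)
    (A : (mkOfModelCanonical X tf rfl hP (fun _ => True) gS gSs NH A₀ hA₀ trivial).C)
    (f : (mkOfModelCanonical X tf rfl hP (fun _ => True) gS gSs NH A₀ hA₀ trivial).biratUnits A) :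
    FractionPair.CondD (f := f) (fun {_} φ x => tf.pullFracModel φ x) :=
  Prop42Sub.condD_mkOfModelCanonical_of_dataRootLaw X tf hP (fun _ => True) gS gSs NH A₀ hA₀ trivial hΦd hTF hR
    (ConnectedPart.hLift_top_of_full_essSurj tf.base) A trivial f

variable [IsTopologicalGroup G]

/-- **Condition (d) at every GALOIS-based object of the canonical §4 model (`IG A := SemiGraphs.IsGaloisObj (tf.base A)` — «Galois», Def. 4.1 (ii))
from E2 (a) on the Def. 3.3 (iii) data ALONE** (`Π` tempered; base full and essentially surjective).
[cite: MochizukiEtTh2009, Def 4.1 (i) p.86] -/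
theorem Prop42Sub.condD_mkOfModelCanonical_galois_of_rootLaw_of_full_essSurj (hG : IsTempered G)
    (gS : ∀ A : D, SemiGraphs.IsGaloisObj (tf.base.obj A).obj → (X.Pi →* Aut A))
    (gSs : ∀ (A : D) (h : SemiGraphs.IsGaloisObj (tf.base.obj A).obj), Function.Surjective (gS A h))
    (NH : Subgroup (Field.absoluteGaloisGroup K) → tf.category → ℕ+ → Prop) (A₀ : tf.category)
    (hA₀ : PreFrobenioid.IsFrobeniusTrivial tf.toElem A₀) (hA₀' : SemiGraphs.IsGaloisObj (tf.base.obj A₀.base).obj)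
    (hΦd : Objectwise (fun M _ => IsDivisorial M) tf.divisorMonoid)
    (hTF : ∀ (A : D) (N : ℕ), 0 < N →
      Function.Injective fun x : Algebra.GrothendieckGroup
        ((RealifiedDivisorMonoids.ofRlfZWeak dm hpf).ΦR.obj (op (tf.base.obj A))) => x ^ N)
    (hR : dm.RootLaw)
    (A : (mkOfModelCanonical X tf rfl hP (fun A => SemiGraphs.IsGaloisObj (tf.base.obj A).obj) gS gSs NH A₀ hA₀ hA₀').C)
    (hA : SemiGraphs.IsGaloisObj (tf.base.obj A.base).obj)
    (f : (mkOfModelCanonical X tf rfl hP (fun A => SemiGraphs.IsGaloisObj (tf.base.obj A).obj) gS gSs NH A₀ hA₀ hA₀').biratUnits A) :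
    FractionPair.CondD (f := f) (fun {_} φ x => tf.pullFracModel φ x) :=
  Prop42Sub.condD_mkOfModelCanonical_of_dataRootLaw X tf hP _ gS gSs NH A₀ hA₀ hA₀' hΦd hTF hR
    (ConnectedPart.hLift_galois_of_full_essSurj tf.base hG) A hA f

end OverBTemp

section Tower

variable (X : SemiGraphs.TemperedArithmeticGroup.{u + 1} K) {P : Type u} [Group P] [TopologicalSpace P]
  [IsTopologicalGroup P] {L : LevelSystem P} (T : LogDivisorTower P L)
  {hpf : ∀ Y : (ConnectedPart (BTemp P))ᵒᵖ, IsPerfFactorialCof ((DivisorMonoids.ofTower T).Φ₀.obj Y)}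
  {D : Type u₀} [Category.{v} D] {VD : FrdICatStub.{u₀, v, u} D}
  (tf : TemperedFrobenioid (RealifiedDivisorMonoids.ofRlfZWeak (DivisorMonoids.ofTower T) hpf) D VD)
  [tf.base.Full] [tf.base.EssSurj] (hP : ∀ A : Dᵒᵖ, IsPerfect (tf.Φ.carrier A))

/-- **The C-R34 (3) chain END TO END at the v2 tower datum**: E2 (a) `RootLaw (ofTower T)` ⟹ condition (d) at every
Galois-based object of the canonical §4 model over `ofTower T` (`Π` tempered; base full, essentially surjective;
standing §4-model binders of p450859). [cite: MochizukiEtTh2009, Def 4.1 (i) p.86] -/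
theorem Prop42Sub.condD_mkOfModelCanonical_ofTower_of_rootLaw (hG : IsTempered P)
    (gS : ∀ A : D, SemiGraphs.IsGaloisObj (tf.base.obj A).obj → (X.Pi →* Aut A))
    (gSs : ∀ (A : D) (h : SemiGraphs.IsGaloisObj (tf.base.obj A).obj), Function.Surjective (gS A h))
    (NH : Subgroup (Field.absoluteGaloisGroup K) → tf.category → ℕ+ → Prop) (A₀ : tf.category)
    (hA₀ : PreFrobenioid.IsFrobeniusTrivial tf.toElem A₀) (hA₀' : SemiGraphs.IsGaloisObj (tf.base.obj A₀.base).obj)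
    (hΦd : Objectwise (fun M _ => IsDivisorial M) tf.divisorMonoid)
    (hTF : ∀ (A : D) (N : ℕ), 0 < N →
      Function.Injective fun x : Algebra.GrothendieckGroup
        ((RealifiedDivisorMonoids.ofRlfZWeak (DivisorMonoids.ofTower T) hpf).ΦR.obj (op (tf.base.obj A))) => x ^ N)
    (hR : (DivisorMonoids.ofTower T).RootLaw)
    (A : (mkOfModelCanonical X tf rfl hP (fun A => SemiGraphs.IsGaloisObj (tf.base.obj A).obj) gS gSs NH A₀ hA₀ hA₀').C)
    (hA : SemiGraphs.IsGaloisObj (tf.base.obj A.base).obj)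
    (f : (mkOfModelCanonical X tf rfl hP (fun A => SemiGraphs.IsGaloisObj (tf.base.obj A).obj) gS gSs NH A₀ hA₀ hA₀').biratUnits A) :
    FractionPair.CondD (f := f) (fun {_} φ x => tf.pullFracModel φ x) :=
  Prop42Sub.condD_mkOfModelCanonical_galois_of_rootLaw_of_full_essSurj X tf hP hG gS gSs NH A₀ hA₀ hA₀' hΦd hTF hR A hA f

end Tower

end BiKummerSetting

end Literature.AnabelianGeometry.EtaleTheta

end
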